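import Literature.Computability.AlgebraicComplexity.ASSS16RecursionBound
import HarnessLib

/-!
# [ASSS16] §4 numerics for the DEPTH-3 base of the recursion: the sparsity budget of the base block
# fits into FSV's `R! · s^R`, `R = (2k)^{2D·2^D}` — proofs only (helper file for `FSV2018_thm48_holds`)

Theorem-only companion of `ASSS16RecursionBound.lean` (the invariant `r_{2+j} ≤ (2k)^{2^{j+3} − 2j − 4}`
of the recursion `asssRec`, [AgrawalSahaSaptharishiSaxena2016] §4) written for val-lit p2 g9's proof
plan of `FSV2018_thm48` AS TYPED (memo `HOME/np/MEMO-p2g9-FSV-thm48-general.md` §3 (iii) / §5 (c):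
"NEW (elementary, in F3): with `P = (2k)^{2^D}`, `R = P^{2D}`, `ρ := r_{D−3} ≤ (2k)^{2^D − 2}`:
(i) `2k(c+ρ)(c+1)ρ ≤ R` and (ii) `ρ·(k(c+ρ)+1)^{c+1} ≤ R` for `c = D−3`, `D ≥ 4`, `k ≥ 1`;
(iii) `ρ!·A^ρ ≤ (ρA)!`; whence `hB` … with `B = R!·s^R` (`s ≥ 1`). Also `1 ≤ R`"). NO definitions,
NO named facts; nothing here bears on `VP` versus `VNP` (NOT proved).

## What is proved (namespace `Literature.Computability.AlgebraicComplexity.ASSS16`)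

With `R = asssR k D = (2k)^{2D·2^D}` (`FSV18SuccinctGenerators.lean`), `r_{2+j} = (asssRec k k j).1`
(`FSV18OccurTopFanIn.lean`), `k ≥ 1`, `D ≥ 4`, any `r ≤ r_{2+(D−3)}` and any order budget `c ≤ D − 3`:

* (private) `factorial_mul_pow_le_factorial_mul` — (iii) `n! · a^n ≤ (n·a)!` (every `n a : ℕ`).
* `asssRec_sub_three_le_pow` — `r_{D−1} = (asssRec k k (D−3)).1 ≤ (2k)^{2^D}` (=: `P`).
* `asssR_eq_pow_pow` — `asssR k D = ((2k)^{2^D})^{2D}`.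
* `depthThree_inner_le` — `k·(c + r) + 1 ≤ P²`.
* `depthThree_exponent_mul_le_asssR` — (i) `(2·(k·(c+r))·(c+1))·r ≤ R`.
* `depthThree_mul_pow_le_asssR` — (ii) `r · (k·(c+r)+1)^{c+1} ≤ R`.
* **`depthThree_budget_le`** — the assembled budget, BINDER-FOR-BINDER the hypothesis `hB` of p2 g9's
  planned `ASSS16.baseLevelDepthThree` at `B = R!·s^R`:
  `r! · ((k·(c+r)+1)^{c+1} · s^{2·(k·(c+r))·(c+1)})^r ≤ R! · s^R` (`s ≥ 1`).
* `one_le_asssR` — `1 ≤ R` for `k ≥ 1` (one seed for the extraction block).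

All estimates are the "easy" bookkeeping the source alludes to ("it is easy to bound `r_{D−2}` by
`R = (2k)^{2D·2^D}`", arXiv:1111.0582 p0010.txt:L40–L43); the depth-3 re-basing of the recursion they
serve is p2 g9's (not in print), see the memo.

## References

* [AgrawalSahaSaptharishiSaxena2016] M. Agrawal, C. Saha, R. Saptharishi, N. Saxena, *Jacobian hits
  circuits: hitting sets, lower bounds for depth-D occur-k formulas and depth-3 transcendence degree-k
  circuits*, SIAM J. Comput. 45 (2016) = arXiv:1111.0582, §4 (held text `paper:arxiv-1111.0582`
  p0010.txt:L16–L19 the recursion, L40–L43 the bound `R`).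
* [ForbesShpilkaVolk2018] M. Forbes, A. Shpilka, B. L. Volk, *Succinct hitting sets and barriers to
  proving lower bounds for algebraic circuits*, Theory of Computing 14 (2018), Thm. 48 (seq.) = ToC
  Thm. 5.24 (the budget `R!·s^R`).
-/

namespace Literature.Computability.AlgebraicComplexity

/-- **(iii)** `n! · a^n ≤ (n·a)!`: the product `a · 2a ⋯ na` is a sub-product of `(na)!` (private
arithmetic helper; consumers use `ASSS16.depthThree_budget_le`). [folklore] -/
private theorem factorial_mul_pow_le_factorial_mul (n a : ℕ) :
    n.factorial * a ^ n ≤ (n * a).factorial := by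
  induction n with
  | zero => simp
  | succ n ih =>
    rcases Nat.eq_zero_or_pos a with rfl | ha
    · simp
    · -- `(n+1)! a^{n+1} = (n! a^n) · ((n+1) a) ≤ (na)! · (na + a) ≤ (na + a)!`
      have h1 : (n + 1).factorial * a ^ (n + 1) = n.factorial * a ^ n * ((n + 1) * a) := by
        rw [Nat.factorial_succ, pow_succ]; ring
      have h2 : (n * a).factorial * ((n + 1) * a) ≤ ((n + 1) * a).factorial := by
        have hna : (n + 1) * a = (n * a + a - 1) + 1 := by
          rw [Nat.succ_mul]; omega
        rw [hna, Nat.factorial_succ, mul_comm ((n * a + a - 1) + 1)]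
        exact Nat.mul_le_mul_right _ (Nat.factorial_le (by omega))
      rw [h1]
      exact (Nat.mul_le_mul_right _ ih).trans h2

namespace ASSS16

open Nat

variable {k D : ℕ}

/-- `R = (2k)^{2D·2^D}` as the `2D`-th power of `P = (2k)^{2^D}`. [cite: AgrawalEtAl2011, §4 (Thm. dDkrPIT, proof)] locator: paper:arxiv-1111.0582 p0010.txt:L40–L43 -/
theorem asssR_eq_pow_pow (k D : ℕ) : asssR k D = ((2 * k) ^ 2 ^ D) ^ (2 * D) := by
  rw [asssR, ← pow_mul, mul_comm (2 ^ D) (2 * D)]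

/-- `1 ≤ R` for `k ≥ 1`. [cite: AgrawalEtAl2011, §4 (Thm. dDkrPIT, proof)] locator: paper:arxiv-1111.0582 p0010.txt:L40–L43 -/
theorem one_le_asssR (hk : 1 ≤ k) (D : ℕ) : 1 ≤ asssR k D :=
  Nat.one_le_pow _ _ (by omega)

/-- The block of the depth-3 base: `r_{2+(D−3)} ≤ (2k)^{2^D − 2(D−3) − 4} ≤ (2k)^{2^D}` (`k ≥ 1`,
`D ≥ 3`). [cite: AgrawalEtAl2011, §4 (Thm. dDkrPIT, proof: "it is easy to bound `r_{D-2}`")] locator: paper:arxiv-1111.0582 p0010.txt:L40–L43 -/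
theorem asssRec_sub_three_le_pow (hk : 1 ≤ k) (hD : 3 ≤ D) :
    (asssRec k k (D - 3)).1 ≤ (2 * k) ^ 2 ^ D := by
  refine (asssRec_fst_le hk le_rfl (D - 3)).trans (Nat.pow_le_pow_right (by omega) ?_)
  rw [show D - 3 + 3 = D by omega]
  exact (Nat.sub_le _ _).trans (Nat.sub_le _ _)

/-- `D ≤ (2k)^{2^D}` (`k ≥ 1`): `D < 2^D ≤ (2k)^D ≤ (2k)^{2^D}`. [folklore] -/
private theorem self_le_pow (hk : 1 ≤ k) (D : ℕ) : D ≤ (2 * k) ^ 2 ^ D :=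
  calc D ≤ 2 ^ D := Nat.lt_two_pow_self.le
    _ ≤ (2 * k) ^ D := Nat.pow_le_pow_left (by omega) D
    _ ≤ (2 * k) ^ 2 ^ D := Nat.pow_le_pow_right (by omega) Nat.lt_two_pow_self.le

/-- `(2k)² ≤ (2k)^{2^D}` for `D ≥ 1`. [folklore] -/
private theorem sq_le_pow (hk : 1 ≤ k) (hD : 1 ≤ D) : (2 * k) ^ 2 ≤ (2 * k) ^ 2 ^ D :=
  Nat.pow_le_pow_right (by omega) (by
    calc 2 = 2 ^ 1 := rfl
      _ ≤ 2 ^ D := Nat.pow_le_pow_right (by norm_num) hD)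

/-- The inner quantity of the base budget: `k·(c + r) + 1 ≤ P²` for `r ≤ r_{2+(D−3)}`, `c ≤ D − 3`,
`P = (2k)^{2^D}` (`k ≥ 1`, `D ≥ 4`). [cite: AgrawalEtAl2011, §4 (Thm. dDkrPIT, proof)] locator: paper:arxiv-1111.0582 p0010.txt:L40–L43 -/
theorem depthThree_inner_le (hk : 1 ≤ k) (hD : 4 ≤ D) {r c : ℕ} (hr : r ≤ (asssRec k k (D - 3)).1)
    (hc : c ≤ D - 3) :
    k * (c + r) + 1 ≤ ((2 * k) ^ 2 ^ D) ^ 2 := by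
  set P := (2 * k) ^ 2 ^ D with hP
  have hPpos : 1 ≤ P := Nat.one_le_pow _ _ (by omega)
  have hrP : r ≤ P := hr.trans (asssRec_sub_three_le_pow hk (by omega))
  have hcP : c ≤ P := (hc.trans (Nat.sub_le _ _)).trans (self_le_pow hk D)
  have hqP : (2 * k) ^ 2 ≤ P := sq_le_pow hk (by omega)
  -- `k (c + r) + 1 ≤ 2kP + 2kP = (2k)·2·P ≤ (2k)²·P ≤ P·P`
  calc k * (c + r) + 1 ≤ k * (P + P) + 2 * k * P :=
        Nat.add_le_add (Nat.mul_le_mul_left _ (Nat.add_le_add hcP hrP)) (by nlinarith)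
    _ = (2 * k) * 2 * P := by ring
    _ ≤ (2 * k) * (2 * k) * P := Nat.mul_le_mul_right _ (Nat.mul_le_mul_left _ (by omega))
    _ = (2 * k) ^ 2 * P := by ring
    _ ≤ P * P := Nat.mul_le_mul_right _ hqP
    _ = P ^ 2 := (sq P).symm

/-- **(i)** the sparsity exponent times the block size fits into `R`:
`(2·(k·(c+r))·(c+1))·r ≤ R` (`r ≤ r_{2+(D−3)}`, `c ≤ D − 3`, `k ≥ 1`, `D ≥ 4`).
[cite: AgrawalEtAl2011, §4 (Thm. dDkrPIT, proof)] locator: paper:arxiv-1111.0582 p0010.txt:L40–L43 -/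
theorem depthThree_exponent_mul_le_asssR (hk : 1 ≤ k) (hD : 4 ≤ D) {r c : ℕ}
    (hr : r ≤ (asssRec k k (D - 3)).1) (hc : c ≤ D - 3) :
    2 * (k * (c + r)) * (c + 1) * r ≤ asssR k D := by
  set P := (2 * k) ^ 2 ^ D with hP
  have hPpos : 1 ≤ P := Nat.one_le_pow _ _ (by omega)
  have h2P : 2 ≤ P := le_trans (by omega : 2 ≤ 2 * k)
    (hP ▸ Nat.le_self_pow (Nat.pos_iff_ne_zero.1 (Nat.two_pow_pos D)) (2 * k))
  have hrP : r ≤ P := hr.trans (asssRec_sub_three_le_pow hk (by omega))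
  have hin : k * (c + r) ≤ P ^ 2 :=
    (Nat.le_succ _).trans (depthThree_inner_le hk hD hr hc)
  have hc1 : c + 1 ≤ P :=
    (Nat.succ_le_succ (hc.trans (Nat.sub_le _ _))).trans
      ((Nat.succ_le_of_lt Nat.lt_two_pow_self).trans
        ((Nat.pow_le_pow_left (by omega : 2 ≤ 2 * k) D).trans
          (Nat.pow_le_pow_right (by omega) Nat.lt_two_pow_self.le)))
  -- `≤ 2 · P² · P · P ≤ P⁵ ≤ P^{2D}`
  calc 2 * (k * (c + r)) * (c + 1) * r ≤ 2 * P ^ 2 * P * P :=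
        Nat.mul_le_mul (Nat.mul_le_mul (Nat.mul_le_mul_left _ hin) hc1) hrP
    _ ≤ P * P ^ 2 * P * P := by gcongr
    _ = P ^ 5 := by ring
    _ ≤ P ^ (2 * D) := Nat.pow_le_pow_right hPpos (by omega)
    _ = asssR k D := (asssR_eq_pow_pow k D).symm

/-- **(ii)** the number of rows times the row-factor sparsity fits into `R`:
`r · (k·(c+r)+1)^{c+1} ≤ R` (`r ≤ r_{2+(D−3)}`, `c ≤ D − 3`, `k ≥ 1`, `D ≥ 4`).
[cite: AgrawalEtAl2011, §4 (Thm. dDkrPIT, proof)] locator: paper:arxiv-1111.0582 p0010.txt:L40–L43 -/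
theorem depthThree_mul_pow_le_asssR (hk : 1 ≤ k) (hD : 4 ≤ D) {r c : ℕ}
    (hr : r ≤ (asssRec k k (D - 3)).1) (hc : c ≤ D - 3) :
    r * (k * (c + r) + 1) ^ (c + 1) ≤ asssR k D := by
  set P := (2 * k) ^ 2 ^ D with hP
  have hPpos : 1 ≤ P := Nat.one_le_pow _ _ (by omega)
  have hrP : r ≤ P := hr.trans (asssRec_sub_three_le_pow hk (by omega))
  have hin : k * (c + r) + 1 ≤ P ^ 2 := depthThree_inner_le hk hD hr hc
  -- `≤ P · (P²)^{c+1} = P^{2c+3} ≤ P^{2D}` since `c ≤ D - 3`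
  calc r * (k * (c + r) + 1) ^ (c + 1) ≤ P * (P ^ 2) ^ (c + 1) :=
        Nat.mul_le_mul hrP (Nat.pow_le_pow_left hin _)
    _ = P ^ (2 * c + 3) := by rw [← pow_mul, ← pow_succ']; congr 1
    _ ≤ P ^ (2 * D) := Nat.pow_le_pow_right hPpos (by omega)
    _ = asssR k D := (asssR_eq_pow_pow k D).symm

/-- **The assembled depth-3 base budget** (binder-for-binder the hypothesis `hB` of the planned
`ASSS16.baseLevelDepthThree` at `B = R!·s^R`): for `k ≥ 1`, `D ≥ 4`, `s ≥ 1`, any block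
`r ≤ r_{2+(D−3)}` and order budget `c ≤ D − 3`,
`r! · ((k·(c+r)+1)^{c+1} · s^{2·(k·(c+r))·(c+1)})^r ≤ R! · s^R`, `R = asssR k D`.
[cite: AgrawalEtAl2011, §4 (Thm. dDkrPIT, proof: sparsity "bounded by `s^R`"); ForbesShpilkaVolk2018, Thm. 48 (seq.) = ToC Thm. 5.24 (`R!·s^R`)]
locator: paper:arxiv-1111.0582 p0010.txt:L40–L55 -/
theorem depthThree_budget_le (hk : 1 ≤ k) (hD : 4 ≤ D) {s r c : ℕ} (hs : 1 ≤ s)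
    (hr : r ≤ (asssRec k k (D - 3)).1) (hc : c ≤ D - 3) :
    r.factorial * ((k * (c + r) + 1) ^ (c + 1) * s ^ (2 * (k * (c + r)) * (c + 1))) ^ r ≤
      (asssR k D).factorial * s ^ asssR k D := by
  have hA := depthThree_mul_pow_le_asssR hk hD hr hc
  have hE := depthThree_exponent_mul_le_asssR hk hD hr hc
  calc r.factorial * ((k * (c + r) + 1) ^ (c + 1) * s ^ (2 * (k * (c + r)) * (c + 1))) ^ r
      = (r.factorial * ((k * (c + r) + 1) ^ (c + 1)) ^ r) *
          s ^ (2 * (k * (c + r)) * (c + 1) * r) := by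
        rw [mul_pow, ← pow_mul s]; ring
    _ ≤ (r * (k * (c + r) + 1) ^ (c + 1)).factorial * s ^ (2 * (k * (c + r)) * (c + 1) * r) :=
        Nat.mul_le_mul_right _ (factorial_mul_pow_le_factorial_mul _ _)
    _ ≤ (asssR k D).factorial * s ^ asssR k D :=
        Nat.mul_le_mul (Nat.factorial_le hA) (Nat.pow_le_pow_right hs hE)

/-- The same at the block of record `r = r_{2+(D−3)}` and `c = D − 3` exactly.
[cite: AgrawalEtAl2011, §4 (Thm. dDkrPIT, proof)] locator: paper:arxiv-1111.0582 p0010.txt:L40–L55 -/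
theorem depthThree_budget_le' (hk : 1 ≤ k) (hD : 4 ≤ D) {s : ℕ} (hs : 1 ≤ s) :
    ((asssRec k k (D - 3)).1).factorial *
        ((k * (D - 3 + (asssRec k k (D - 3)).1) + 1) ^ (D - 3 + 1) *
          s ^ (2 * (k * (D - 3 + (asssRec k k (D - 3)).1)) * (D - 3 + 1))) ^ (asssRec k k (D - 3)).1 ≤
      (asssR k D).factorial * s ^ asssR k D :=
  depthThree_budget_le hk hD hs le_rfl le_rfl

end ASSS16

end Literature.Computability.AlgebraicComplexity
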